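import Summits.AnomalousDissipation.AnomalousDissipation.Theorems.SawtoothPulseCascadeK1LocalisedCascadeKHBlockEntries

/-!
# K2 lane (route-2 `SawtoothPulseCascade`, crux dir `K1LocalisedCascade`): numeric ATOMS of the twelve-term creation bound (`a ≥ 1`)

Helper file of the K2 lane (ACL item stmt-AnomalousDissipation-19491; S2-cert forced part / P1″). Each term of the twelve-term bound (`…KHSourceResponse`) is
`‖c‖·e^{μy_b}·(2+π)/|μ|·(1/|φ_b−ω| + 1/|φ_b+ω|)·r` with `c = (pref)·A·e^{−κm₀}` or `(pref)·B·e^{κm₀}`, `μ = ±κ`, `κ = 2πa`, `φ_b ∈ {0, ±πa/2}`. For `a ≥ 1`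
and `ω` in the window `[0.55a, πa/2 − 399/401]` (`omega_ge`, `omega_le`) the atoms are:
* decay factors `e^{−κd}`, `d ∈ {¼, ½, ¾, 1}`: `≤ 0.2237, 1/20, 0.0112, 1/400` (`exp_neg_kappa_*`; from `q = e^{−κ} ≤ 1/400`);
* heights: `‖pref·A·e^{−κm}‖·e^{κy} = ‖A‖e^{−κ(m−y)}` and `‖pref·B·e^{κm}‖·e^{−κy} = (‖B‖/q)·e^{−κ(1−(m−y))}` with `‖A‖, ‖B‖/q ≤ 1/((1−q)2κ)`
  (`heightA_le`, `heightA_conj_le`, `heightB_le`, `heightB_conj_le`);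
* detuning factors: `1/|πa/2−ω| + 1/|πa/2+ω| ≤ 1.48`, the same for `−πa/2`, and `1/|0−ω| + 1/|0+ω| ≤ 40/(11a)` (`detune_*`);
* the monotone term lemma `term_le_of`.
No definitions; no statement about the crux. [folklore] [problem: turb]
-/

-- `Summit.<Summit>.<Problem>`: single-conjunct summit, the duplicate namespace segment is deliberate.
set_option linter.dupNamespace false

noncomputable section

namespace Summit.AnomalousDissipation.AnomalousDissipation.Theorems.SawtoothPulseCascade.K2PhaseBudget

open Set Literature.Analysis.FluidPDE.SawtoothCascade

/-! ## §1 Decay factors -/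

/-- `e^{−2πa} = sawQ a ≤ 1/400` for `a ≥ 1`, in `Real.exp` form. [folklore] -/
theorem exp_neg_kappa_le {a : ℝ} (ha : 1 ≤ a) : Real.exp (-(2 * Real.pi * a)) ≤ 1 / 400 := sawQ_le_of_one_le ha

/-- `e^{−κ/2} ≤ 1/20` for `a ≥ 1` (`(e^{−κ/2})² = e^{−κ} ≤ 1/400`). [folklore] -/
theorem exp_neg_kappa_half_le {a : ℝ} (ha : 1 ≤ a) : Real.exp (-(2 * Real.pi * a) * (1 / 2)) ≤ 1 / 20 := by
  have h := exp_neg_kappa_le ha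
  have e : Real.exp (-(2 * Real.pi * a) * (1 / 2)) ^ 2 = Real.exp (-(2 * Real.pi * a)) := by
    rw [← Real.exp_nat_mul]; congr 1; push_cast; ring
  have h0 : 0 ≤ Real.exp (-(2 * Real.pi * a) * (1 / 2)) := (Real.exp_pos _).le
  nlinarith

/-- `e^{−κ/4} ≤ 0.2237` for `a ≥ 1` (`(e^{−κ/4})⁴ = e^{−κ} ≤ 1/400 < 0.2237⁴`). [folklore] -/
theorem exp_neg_kappa_quarter_le {a : ℝ} (ha : 1 ≤ a) : Real.exp (-(2 * Real.pi * a) * (1 / 4)) ≤ 0.2237 := by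
  have h := exp_neg_kappa_le ha
  set t := Real.exp (-(2 * Real.pi * a) * (1 / 4)) with ht
  have e : t ^ 4 = Real.exp (-(2 * Real.pi * a)) := by
    rw [ht, ← Real.exp_nat_mul]; congr 1; push_cast; ring
  have h0 : 0 ≤ t := (Real.exp_pos _).le
  by_contra hc
  have hc' : (0.2237 : ℝ) < t := lt_of_not_ge hc
  have h4 : (0.2237 : ℝ) ^ 4 < t ^ 4 := pow_lt_pow_left₀ hc' (by norm_num) (by norm_num)
  rw [e] at h4
  norm_num at h4
  linarith

/-- `e^{−3κ/4} ≤ 0.0112` for `a ≥ 1`. [folklore] -/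
theorem exp_neg_kappa_threeQuarter_le {a : ℝ} (ha : 1 ≤ a) : Real.exp (-(2 * Real.pi * a) * (3 / 4)) ≤ 0.0112 := by
  have e : Real.exp (-(2 * Real.pi * a) * (3 / 4)) = Real.exp (-(2 * Real.pi * a) * (1 / 2)) * Real.exp (-(2 * Real.pi * a) * (1 / 4)) := by
    rw [← Real.exp_add]; congr 1; ring
  rw [e]
  have h1 := exp_neg_kappa_half_le ha
  have h2 := exp_neg_kappa_quarter_le ha
  have h0 : 0 ≤ Real.exp (-(2 * Real.pi * a) * (1 / 4)) := (Real.exp_pos _).le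
  have h0' : 0 ≤ Real.exp (-(2 * Real.pi * a) * (1 / 2)) := (Real.exp_pos _).le
  nlinarith

/-! ## §2 Heights -/

/-- `‖e^{w}‖ = e^{Re w}` for the real products appearing in the coefficients: `‖exp(−κ·m)‖·e^{κy} = e^{−κ(m−y)}` (as `Complex.exp` of real casts). [folklore] -/
theorem norm_cexp_neg_mul_mul_exp (a m y : ℝ) :
    ‖Complex.exp (-((2 * Real.pi * a : ℝ) : ℂ) * (m : ℂ))‖ * Real.exp ((2 * Real.pi * a) * y) = Real.exp (-(2 * Real.pi * a) * (m - y)) := by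
  rw [show -((2 * Real.pi * a : ℝ) : ℂ) * (m : ℂ) = ((-(2 * Real.pi * a) * m : ℝ) : ℂ) by push_cast; ring, Complex.norm_exp_ofReal,
    ← Real.exp_add]
  congr 1; ring

/-- The same for the `B`-type coefficient: `‖exp(κ·m)‖·e^{−κy} = e^{κ(m−y)}`. [folklore] -/
theorem norm_cexp_mul_mul_exp (a m y : ℝ) :
    ‖Complex.exp (((2 * Real.pi * a : ℝ) : ℂ) * (m : ℂ))‖ * Real.exp ((-(2 * Real.pi * a)) * y) = Real.exp ((2 * Real.pi * a) * (m - y)) := by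
  rw [show ((2 * Real.pi * a : ℝ) : ℂ) * (m : ℂ) = (((2 * Real.pi * a) * m : ℝ) : ℂ) by push_cast; ring, Complex.norm_exp_ofReal,
    ← Real.exp_add]
  congr 1; ring

/-- **Height of an `A`-type term:** `‖P·A·e^{−κm}‖·e^{κy} ≤ ε/((1−q)·2κ)` when `‖P‖ = 1` and `e^{−κ(m−y)} ≤ ε` (`a > 0`). [folklore] -/
theorem heightA_le {a : ℝ} (ha : 0 < a) (β : ℝ) {P : ℂ} (hP : ‖P‖ = 1) {m y ε : ℝ}
    (hε : Real.exp (-(2 * Real.pi * a) * (m - y)) ≤ ε) :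
    ‖P * (-1 / ((1 - starRingEnd ℂ (Complex.exp (2 * Real.pi * β * Complex.I)) * (Real.exp (-(2 * Real.pi * a)) : ℂ)) * (2 * (2 * Real.pi * a)))) *
        Complex.exp (-((2 * Real.pi * a : ℝ) : ℂ) * (m : ℂ))‖ * Real.exp ((2 * Real.pi * a) * y) ≤
      ε / ((1 - Real.exp (-(2 * Real.pi * a))) * (2 * (2 * Real.pi * a))) := by
  have hA := norm_coefA_le ha β
  rw [norm_mul, norm_mul, hP, one_mul, mul_assoc, norm_cexp_neg_mul_mul_exp]
  have hq1 : Real.exp (-(2 * Real.pi * a)) < 1 := Real.exp_lt_one_iff.2 (by nlinarith [Real.pi_pos])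
  have hden : 0 < (1 - Real.exp (-(2 * Real.pi * a))) * (2 * (2 * Real.pi * a)) := by
    have : 0 < 2 * (2 * Real.pi * a) := by positivity
    nlinarith
  calc _ ≤ 1 / ((1 - Real.exp (-(2 * Real.pi * a))) * (2 * (2 * Real.pi * a))) * ε :=
        mul_le_mul hA hε (Real.exp_pos _).le (by positivity)
    _ = ε / ((1 - Real.exp (-(2 * Real.pi * a))) * (2 * (2 * Real.pi * a))) := by ring

/-- **Height of a `B`-type term:** `‖P·B·e^{κm}‖·e^{−κy} ≤ ε/((1−q)·2κ)` when `‖P‖ = 1` and `e^{−κ(1−(m−y))} ≤ ε`. [folklore] -/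
theorem heightB_le {a : ℝ} (ha : 0 < a) (β : ℝ) {P : ℂ} (hP : ‖P‖ = 1) {m y ε : ℝ}
    (hε : Real.exp (-(2 * Real.pi * a) * (1 - (m - y))) ≤ ε) :
    ‖P * (-(Complex.exp (2 * Real.pi * β * Complex.I) * (Real.exp (-(2 * Real.pi * a)) : ℂ)) /
        ((1 - Complex.exp (2 * Real.pi * β * Complex.I) * (Real.exp (-(2 * Real.pi * a)) : ℂ)) * (2 * (2 * Real.pi * a)))) *
        Complex.exp (((2 * Real.pi * a : ℝ) : ℂ) * (m : ℂ))‖ * Real.exp ((-(2 * Real.pi * a)) * y) ≤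
      ε / ((1 - Real.exp (-(2 * Real.pi * a))) * (2 * (2 * Real.pi * a))) := by
  have hB := norm_coefB_le ha β
  rw [norm_mul, norm_mul, hP, one_mul, mul_assoc, norm_cexp_mul_mul_exp]
  have hq1 : Real.exp (-(2 * Real.pi * a)) < 1 := Real.exp_lt_one_iff.2 (by nlinarith [Real.pi_pos])
  have hκ : 0 < 2 * (2 * Real.pi * a) := by positivity
  have hden : 0 < (1 - Real.exp (-(2 * Real.pi * a))) * (2 * (2 * Real.pi * a)) := by nlinarith
  have hq : Real.exp (-(2 * Real.pi * a)) * Real.exp ((2 * Real.pi * a) * (m - y)) = Real.exp (-(2 * Real.pi * a) * (1 - (m - y))) := by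
    rw [← Real.exp_add]; congr 1; ring
  calc _ ≤ Real.exp (-(2 * Real.pi * a)) / ((1 - Real.exp (-(2 * Real.pi * a))) * (2 * (2 * Real.pi * a))) *
        Real.exp ((2 * Real.pi * a) * (m - y)) := mul_le_mul_of_nonneg_right hB (Real.exp_pos _).le
    _ = Real.exp (-(2 * Real.pi * a) * (1 - (m - y))) / ((1 - Real.exp (-(2 * Real.pi * a))) * (2 * (2 * Real.pi * a))) := by
        rw [div_mul_eq_mul_div, hq]
    _ ≤ _ := div_le_div_of_nonneg_right hε hden.le

/-- `‖1‖ = 1` and `‖conj z‖ = 1` for the two prefactors. [folklore] -/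
theorem norm_pref_conj (β : ℝ) : ‖starRingEnd ℂ (Complex.exp (2 * Real.pi * β * Complex.I))‖ = 1 := by
  rw [Complex.norm_conj, show (2 * Real.pi * β * Complex.I : ℂ) = ((2 * Real.pi * β : ℝ) : ℂ) * Complex.I by push_cast; ring]
  exact Complex.norm_exp_ofReal_mul_I _

/-! ## §3 Detuning factors (ω in the window `[0.55a, πa/2 − 399/401]`, `a ≥ 1`) -/

/-- Kink phase `+πa/2`: `1/|πa/2 − ω| + 1/|πa/2 + ω| ≤ 1.48`. [folklore] -/
theorem detune_pos_le {a ω : ℝ} (ha : 1 ≤ a) (hlo : 0.55 * a ≤ ω) (hhi : ω ≤ Real.pi * a / 2 - 399 / 401) :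
    1 / |Real.pi * a / 2 - ω| + 1 / |Real.pi * a / 2 + ω| ≤ 1.48 := by
  have hπ : (3.1415 : ℝ) < Real.pi := Real.pi_gt_d4
  have h1 : 399 / 401 ≤ Real.pi * a / 2 - ω := by linarith
  have h2 : 2.12 ≤ Real.pi * a / 2 + ω := by nlinarith
  rw [abs_of_pos (by linarith), abs_of_pos (by linarith)]
  have b1 : 1 / (Real.pi * a / 2 - ω) ≤ 401 / 399 := by
    rw [div_le_div_iff₀ (by linarith) (by norm_num)]; linarith
  have b2 : 1 / (Real.pi * a / 2 + ω) ≤ 1 / 2.12 := one_div_le_one_div_of_le (by norm_num) h2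
  have : (401 : ℝ) / 399 + 1 / 2.12 ≤ 1.48 := by norm_num
  linarith

/-- Kink phase `−πa/2`: `1/|−πa/2 − ω| + 1/|−πa/2 + ω| ≤ 1.48`. [folklore] -/
theorem detune_neg_le {a ω : ℝ} (ha : 1 ≤ a) (hlo : 0.55 * a ≤ ω) (hhi : ω ≤ Real.pi * a / 2 - 399 / 401) :
    1 / |-(Real.pi * a / 2) - ω| + 1 / |-(Real.pi * a / 2) + ω| ≤ 1.48 := by
  have h := detune_pos_le ha hlo hhi
  rw [show |-(Real.pi * a / 2) - ω| = |Real.pi * a / 2 + ω| by rw [← abs_neg]; congr 1; ring,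
    show |-(Real.pi * a / 2) + ω| = |Real.pi * a / 2 - ω| by rw [← abs_neg]; congr 1; ring]
  linarith

/-- Frequency `0`: `1/|0 − ω| + 1/|0 + ω| ≤ 40/(11a)` (`ω ≥ 0.55a`). [folklore] -/
theorem detune_zero_le {a ω : ℝ} (ha : 1 ≤ a) (hlo : 0.55 * a ≤ ω) :
    1 / |(0 : ℝ) - ω| + 1 / |(0 : ℝ) + ω| ≤ 40 / (11 * a) := by
  have hω : 0 < ω := by linarith
  rw [zero_sub, zero_add, abs_neg, abs_of_pos hω, ← two_mul, mul_one_div, div_le_div_iff₀ hω (by positivity)]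
  nlinarith

/-! ## §4 The monotone term lemma -/

/-- **One term:** from a height bound `‖c‖e^{μy} ≤ H`, `|μ| = κ`, a detuning bound `≤ D` and `0 ≤ r`:
`‖c‖·e^{μy}·(2+π)/|μ|·(detuning)·r ≤ H·(2+π)/κ·D·r`. [folklore] -/
theorem term_le_of {nc E μ κ det r H D : ℝ} (hnc : 0 ≤ nc) (hE : 0 ≤ E) (hH : nc * E ≤ H) (hμ : |μ| = κ) (hκ : 0 < κ)
    (hdet0 : 0 ≤ det) (hdet : det ≤ D) (hr : 0 ≤ r) :
    nc * E * (2 + Real.pi) / |μ| * det * r ≤ H * (2 + Real.pi) / κ * D * r := by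
  rw [hμ]
  have hπ : 0 < 2 + Real.pi := by linarith [Real.pi_pos]
  have hH0 : 0 ≤ H := le_trans (mul_nonneg hnc hE) hH
  have h1 : nc * E * (2 + Real.pi) / κ ≤ H * (2 + Real.pi) / κ := by
    apply div_le_div_of_nonneg_right _ hκ.le
    exact mul_le_mul_of_nonneg_right hH hπ.le
  have h2 : 0 ≤ H * (2 + Real.pi) / κ := by positivity
  calc nc * E * (2 + Real.pi) / κ * det * r ≤ H * (2 + Real.pi) / κ * det * r := by gcongr
    _ ≤ H * (2 + Real.pi) / κ * D * r := by gcongr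

end Summit.AnomalousDissipation.AnomalousDissipation.Theorems.SawtoothPulseCascade.K2PhaseBudget

end
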